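import Mathlib
import HarnessLib

/-!
# The second moment from a two-sided bound on the weighted moment generating function — the `t → 0` end of a Schwinger–Dyson ⟹ Gaussian-domination argument

Crux of record `UnitScaleTilt.HistoryTailL` (stmt-QuantumFields-19936), cell `ym3-torus` (YM ladder rung R3 = continuum SU(2) Yang–Mills on T³ — a RUNG, NOT the
Clay problem); width seat `ym3-torus-px9` gen 9.  Pure real analysis ∕ measure theory (Mathlib only); the SECOND-MOMENT EXTRACTION row of the crux idea
«gross-sd-transfer» (LINE 28 candidate, `Cruxes/HistoryTailL/Ideas/gross-sd-transfer.md`, annex 1 §3 «Assembly (kernel, S): Chernoff∕second-moment extraction at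
`t → 0` and `t = t*`», annex 2 §3), complementary to the TAIL extraction at `t = t*` (twin-width seat w8 g9's «Grönwall + weighted MGF + Chernoff» letters): once the
Grönwall step has produced, for the weighted Laplace transform `ψ(s) = ∫ e^{sX}·χ dμ` of a flux functional `X` AND of `−X`, the Gaussian-domination bound
`ψ(±t) ≤ ψ(0)·exp(a t²∕2 + Δ t)` at ONE `t > 0`, the weighted second moment obeys

* §1 ★★ `integral_sq_mul_weight_le_of_mgf_two_sided` — `∫ X²·χ dμ ≤ (C₊ + C₋ − 2∫χ dμ) ∕ t²` from `∫ e^{tX}χ ≤ C₊`, `∫ e^{−tX}χ ≤ C₋` (pointwise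
  `2 + (tX)² ≤ e^{tX} + e^{−tX}`);
* §2 ★★ `integral_sq_mul_weight_le_of_subgaussian_mgf` — with `C± = (∫χ)·exp(a t²∕2 + Δ t)`: `∫ X²χ ≤ (2∕t²)·(exp(a t²∕2 + Δ t) − 1)·∫χ ≤ (a + 2Δ∕t)·exp(a t²∕2 + Δ t)·∫χ`
  — the defect rate `Δ` of the differential inequality costs `2Δ∕t` at the extraction point `t` (so a second-moment bound of Gaussian size `≍ a` needs `Δ ≲ t·a` at some
  `t ≲ a^{−1∕2}`, i.e. `Δ ≲ √a` — recorded for the line's bookkeeping; the TAIL at `t*` tolerates the weaker `Δ·t* ≪ p²`);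
* §3 ★★★ `integral_sq_mul_weight_le_of_subgaussian_mgf_nhds` — DEFECT-FREE LIMIT: if the two-sided bound holds with `Δ = 0` for all `t ∈ (0, T]`, then
  `∫ X²·χ dμ ≤ a·∫χ dμ` (let `t → 0⁺`) — Gaussian domination of the weighted variance, the shape of the LINE 28 target «BlockSecondMomentL»
  (`E_K[dist₁(Ū^j(∂a))²·χ_G] ≤ C·g²_{K−j}`, consumed Theorems-side by ✓`PoincareLipschitzMeanDeviationOfSecondMoment`).

THEOREMS ONLY (0 `def`, 0 `sorry`); `--supports stmt-QuantumFields-19936 --as helper`.  HONEST SCOPE: generic letters; the MGF bounds themselves (the content of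
S_SD ∕ S_dom: the Schwinger–Dyson differential inequality and its Grönwall integration) are HYPOTHESES here; nothing of (Q), «BlockSecondMomentL», K1, `MeanDeviationL`,
`HistoryTailL`, R3, d = 4, a continuum limit or a mass gap is proved; the Yang–Mills mass gap is NOT proved.

References: L. Gross, Convergence of U(1)₃ lattice gauge theory to its continuum limit, CMP 92 (1983) 137–162, Thm 2.2 [GrossCMP1983]; S. Boucheron, G. Lugosi,
P. Massart, Concentration Inequalities (2013), §2.2–§2.3 (Cramér–Chernoff, sub-Gaussian variance proxy bounds the variance) [BoucheronLugosiMassart2013].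
-/

set_option autoImplicit false

noncomputable section

open MeasureTheory Set Filter Topology

namespace Summit.QuantumFields.YangMills.Theorems.UnitScaleGibbsMGFSecondMoment

/-! ## §1 The weighted second moment from a two-sided MGF bound at one point -/

section Weighted

variable {Ω : Type*} [MeasurableSpace Ω] (μ : Measure Ω) [IsFiniteMeasure μ]
variable {X χ : Ω → ℝ} {B M : ℝ}

/-- Integrability bookkeeping: a measurable function bounded by a constant is integrable under a finite measure. [folklore] -/
theorem integrable_of_abs_le {f : Ω → ℝ} {C : ℝ} (hfm : Measurable f) (hf : ∀ ω, |f ω| ≤ C) : Integrable f μ :=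
  (integrable_const C).mono' hfm.aestronglyMeasurable (ae_of_all _ fun ω => by rw [Real.norm_eq_abs]; exact hf ω)

/-- ★★ **THE WEIGHTED SECOND MOMENT FROM A TWO-SIDED MGF BOUND AT ONE POINT.**  For a finite measure `μ`, a bounded measurable `X`, a bounded measurable weight
`0 ≤ χ`, and `t ≠ 0`: if `∫ e^{tX}·χ dμ ≤ C₊` and `∫ e^{−tX}·χ dμ ≤ C₋`, then `∫ X²·χ dμ ≤ (C₊ + C₋ − 2∫χ dμ) ∕ t²` — integrate the pointwise
`(2 + t²X²)·χ ≤ (e^{tX} + e^{−tX})·χ`. [cite: BoucheronLugosiMassart2013, §2.3] -/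
theorem integral_sq_mul_weight_le_of_mgf_two_sided (hXm : Measurable X) (hχm : Measurable χ)
    (hXB : ∀ ω, |X ω| ≤ B) (hχ0 : ∀ ω, 0 ≤ χ ω) (hχM : ∀ ω, χ ω ≤ M) {t : ℝ} (ht : t ≠ 0) {Cp Cm : ℝ}
    (hp : ∫ ω, Real.exp (t * X ω) * χ ω ∂μ ≤ Cp) (hm : ∫ ω, Real.exp (-t * X ω) * χ ω ∂μ ≤ Cm) :
    ∫ ω, X ω ^ 2 * χ ω ∂μ ≤ (Cp + Cm - 2 * ∫ ω, χ ω ∂μ) / t ^ 2 := by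
  -- integrability of the four integrands (all bounded and measurable)
  have hM0 : ∀ ω, |χ ω| ≤ M := fun ω => by rw [abs_of_nonneg (hχ0 ω)]; exact hχM ω
  have hiχ : Integrable χ μ := integrable_of_abs_le μ hχm hM0
  have hiX2 : Integrable (fun ω => X ω ^ 2 * χ ω) μ := by
    refine integrable_of_abs_le μ ((hXm.pow_const 2).mul hχm) (C := B ^ 2 * M) fun ω => ?_
    rw [abs_mul, abs_of_nonneg (sq_nonneg _), abs_of_nonneg (hχ0 ω)]
    have h1 : X ω ^ 2 ≤ B ^ 2 := by
      have := hXB ω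
      have hb : -B ≤ X ω ∧ X ω ≤ B := abs_le.mp this
      nlinarith [hb.1, hb.2]
    exact mul_le_mul h1 (hχM ω) (hχ0 ω) (sq_nonneg _)
  have hiE : ∀ s : ℝ, Integrable (fun ω => Real.exp (s * X ω) * χ ω) μ := by
    intro s
    refine integrable_of_abs_le μ (((measurable_const.mul hXm).exp).mul hχm) (C := Real.exp (|s| * B) * M) fun ω => ?_
    rw [abs_mul, abs_of_nonneg (Real.exp_pos _).le, abs_of_nonneg (hχ0 ω)]
    refine mul_le_mul (Real.exp_le_exp.mpr ?_) (hχM ω) (hχ0 ω) (Real.exp_pos _).le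
    calc s * X ω ≤ |s * X ω| := le_abs_self _
      _ = |s| * |X ω| := abs_mul _ _
      _ ≤ |s| * B := mul_le_mul_of_nonneg_left (hXB ω) (abs_nonneg _)
  -- the pointwise inequality, integrated
  have hpt : ∀ ω, (2 + t ^ 2 * X ω ^ 2) * χ ω ≤ Real.exp (t * X ω) * χ ω + Real.exp (-t * X ω) * χ ω := by
    intro ω
    -- `2 + y² ≤ e^{y} + e^{−y}` (first two terms of the cosh series; = lit `NVector.two_add_sq_le_exp_add_exp_neg`, inlined to keep the imports Mathlib-only)
    have h : 2 + (t * X ω) ^ 2 ≤ Real.exp (t * X ω) + Real.exp (-(t * X ω)) := by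
      have hs := sum_le_hasSum (Finset.range 2)
        (fun n _ => div_nonneg (by rw [pow_mul]; positivity) (Nat.cast_nonneg _)) (Real.hasSum_cosh (t * X ω))
      have h2 : 1 + (t * X ω) ^ 2 / 2 ≤ Real.cosh (t * X ω) := by
        simpa [Finset.sum_range_succ, Nat.factorial] using hs
      rw [Real.cosh_eq] at h2
      linarith
    have h' : 2 + t ^ 2 * X ω ^ 2 ≤ Real.exp (t * X ω) + Real.exp (-t * X ω) := by
      rw [mul_pow] at h; rw [neg_mul]; exact h
    nlinarith [mul_le_mul_of_nonneg_right h' (hχ0 ω)]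
  have hL : Integrable (fun ω => (2 + t ^ 2 * X ω ^ 2) * χ ω) μ := by
    have : (fun ω => (2 + t ^ 2 * X ω ^ 2) * χ ω) = fun ω => 2 * χ ω + t ^ 2 * (X ω ^ 2 * χ ω) := by
      funext ω; ring
    rw [this]
    exact (hiχ.const_mul 2).add (hiX2.const_mul _)
  have hR : Integrable (fun ω => Real.exp (t * X ω) * χ ω + Real.exp (-t * X ω) * χ ω) μ := (hiE t).add (hiE (-t))
  have hint := integral_mono hL hR hpt
  have hsplitL : ∫ ω, (2 + t ^ 2 * X ω ^ 2) * χ ω ∂μ = 2 * ∫ ω, χ ω ∂μ + t ^ 2 * ∫ ω, X ω ^ 2 * χ ω ∂μ := by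
    have : (fun ω => (2 + t ^ 2 * X ω ^ 2) * χ ω) = fun ω => 2 * χ ω + t ^ 2 * (X ω ^ 2 * χ ω) := by
      funext ω; ring
    rw [this, integral_add (hiχ.const_mul 2) (hiX2.const_mul _), integral_const_mul, integral_const_mul]
  have hsplitR : ∫ ω, (Real.exp (t * X ω) * χ ω + Real.exp (-t * X ω) * χ ω) ∂μ
      = ∫ ω, Real.exp (t * X ω) * χ ω ∂μ + ∫ ω, Real.exp (-t * X ω) * χ ω ∂μ := integral_add (hiE t) (hiE (-t))
  rw [hsplitL, hsplitR] at hint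
  have ht2 : 0 < t ^ 2 := by positivity
  rw [le_div_iff₀ ht2]
  linarith

/-! ## §2 With the Gaussian-domination shape `C± = (∫χ)·exp(a t²∕2 + Δ t)` -/

/-- ★★ **SECOND MOMENT UNDER A SUB-GAUSSIAN TWO-SIDED MGF BOUND WITH A DEFECT RATE.**  If at some `t > 0` both `∫ e^{±tX}·χ dμ ≤ (∫χ dμ)·exp(a t²∕2 + Δ t)`, then
`∫ X²·χ dμ ≤ (2 ∕ t²)·(exp(a t²∕2 + Δ t) − 1)·∫χ dμ`. [cite: GrossCMP1983, Thm 2.2; BoucheronLugosiMassart2013, §2.3] -/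
theorem integral_sq_mul_weight_le_of_subgaussian_mgf (hXm : Measurable X) (hχm : Measurable χ)
    (hXB : ∀ ω, |X ω| ≤ B) (hχ0 : ∀ ω, 0 ≤ χ ω) (hχM : ∀ ω, χ ω ≤ M) {t a Δ : ℝ} (ht : 0 < t)
    (hp : ∫ ω, Real.exp (t * X ω) * χ ω ∂μ ≤ (∫ ω, χ ω ∂μ) * Real.exp (a * t ^ 2 / 2 + Δ * t))
    (hm : ∫ ω, Real.exp (-t * X ω) * χ ω ∂μ ≤ (∫ ω, χ ω ∂μ) * Real.exp (a * t ^ 2 / 2 + Δ * t)) :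
    ∫ ω, X ω ^ 2 * χ ω ∂μ ≤ 2 / t ^ 2 * (Real.exp (a * t ^ 2 / 2 + Δ * t) - 1) * ∫ ω, χ ω ∂μ := by
  have h := integral_sq_mul_weight_le_of_mgf_two_sided μ hXm hχm hXB hχ0 hχM ht.ne' hp hm
  have ht2 : 0 < t ^ 2 := by positivity
  calc ∫ ω, X ω ^ 2 * χ ω ∂μ
      ≤ ((∫ ω, χ ω ∂μ) * Real.exp (a * t ^ 2 / 2 + Δ * t) + (∫ ω, χ ω ∂μ) * Real.exp (a * t ^ 2 / 2 + Δ * t)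
          - 2 * ∫ ω, χ ω ∂μ) / t ^ 2 := h
    _ = 2 / t ^ 2 * (Real.exp (a * t ^ 2 / 2 + Δ * t) - 1) * ∫ ω, χ ω ∂μ := by
        field_simp
        ring

/-- ★★ The same with the elementary `e^{y} − 1 ≤ y·e^{y}` (`y = a t²∕2 + Δ t ≥ 0`): `∫ X²·χ dμ ≤ (a + 2Δ∕t)·exp(a t²∕2 + Δ t)·∫χ dμ` — the defect rate `Δ` costs
`2Δ∕t` at the extraction point. [cite: GrossCMP1983, Thm 2.2; BoucheronLugosiMassart2013, §2.3] -/
theorem integral_sq_mul_weight_le_of_subgaussian_mgf' (hXm : Measurable X) (hχm : Measurable χ)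
    (hXB : ∀ ω, |X ω| ≤ B) (hχ0 : ∀ ω, 0 ≤ χ ω) (hχM : ∀ ω, χ ω ≤ M) {t a Δ : ℝ} (ht : 0 < t) (ha : 0 ≤ a) (hΔ : 0 ≤ Δ)
    (hp : ∫ ω, Real.exp (t * X ω) * χ ω ∂μ ≤ (∫ ω, χ ω ∂μ) * Real.exp (a * t ^ 2 / 2 + Δ * t))
    (hm : ∫ ω, Real.exp (-t * X ω) * χ ω ∂μ ≤ (∫ ω, χ ω ∂μ) * Real.exp (a * t ^ 2 / 2 + Δ * t)) :
    ∫ ω, X ω ^ 2 * χ ω ∂μ ≤ (a + 2 * Δ / t) * Real.exp (a * t ^ 2 / 2 + Δ * t) * ∫ ω, χ ω ∂μ := by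
  have h := integral_sq_mul_weight_le_of_subgaussian_mgf μ hXm hχm hXB hχ0 hχM ht hp hm
  have hχint : 0 ≤ ∫ ω, χ ω ∂μ := integral_nonneg hχ0
  set y : ℝ := a * t ^ 2 / 2 + Δ * t with hy
  have hy0 : 0 ≤ y := by rw [hy]; positivity
  -- `e^{y} − 1 ≤ y·e^{y}` (from `1 − y ≤ e^{−y}`; = lit `AreaLaw.exp_sub_one_le_mul_exp`, inlined to keep the imports Mathlib-only)
  have he : Real.exp y - 1 ≤ y * Real.exp y := by
    have h := Real.add_one_le_exp (-y)
    have hpos := Real.exp_pos y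
    have hprod : Real.exp (-y) * Real.exp y = 1 := by rw [← Real.exp_add]; simp
    nlinarith [mul_le_mul_of_nonneg_right h hpos.le]
  have ht2 : 0 < t ^ 2 := by positivity
  have hcoef : 2 / t ^ 2 * (Real.exp y - 1) ≤ (a + 2 * Δ / t) * Real.exp y := by
    have h1 : 2 / t ^ 2 * (Real.exp y - 1) ≤ 2 / t ^ 2 * (y * Real.exp y) :=
      mul_le_mul_of_nonneg_left he (by positivity)
    have h2 : 2 / t ^ 2 * (y * Real.exp y) = (a + 2 * Δ / t) * Real.exp y := by
      rw [hy]; field_simp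
    linarith
  exact h.trans (mul_le_mul_of_nonneg_right hcoef hχint)

/-! ## §3 The defect-free limit `t → 0⁺`: Gaussian domination of the weighted variance -/

/-- ★★★ **GAUSSIAN DOMINATION OF THE WEIGHTED SECOND MOMENT** (defect-free limit): if for every `t ∈ (0, T]` both
`∫ e^{±tX}·χ dμ ≤ (∫χ dμ)·exp(a t²∕2)`, then `∫ X²·χ dμ ≤ a·∫χ dμ` — from §2 with `Δ = 0`, `∫ X²χ ≤ a·e^{a t²∕2}·∫χ` for every small `t > 0`, and `t → 0⁺`.
This is the shape in which a Schwinger–Dyson ∕ Grönwall argument delivers the LINE 28 target «BlockSecondMomentL». [cite: GrossCMP1983, Thm 2.2; BoucheronLugosiMassart2013, §2.3] -/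
theorem integral_sq_mul_weight_le_of_subgaussian_mgf_nhds (hXm : Measurable X) (hχm : Measurable χ)
    (hXB : ∀ ω, |X ω| ≤ B) (hχ0 : ∀ ω, 0 ≤ χ ω) (hχM : ∀ ω, χ ω ≤ M) {T a : ℝ} (hT : 0 < T) (ha : 0 ≤ a)
    (hp : ∀ t ∈ Ioc (0 : ℝ) T, ∫ ω, Real.exp (t * X ω) * χ ω ∂μ ≤ (∫ ω, χ ω ∂μ) * Real.exp (a * t ^ 2 / 2))
    (hm : ∀ t ∈ Ioc (0 : ℝ) T, ∫ ω, Real.exp (-t * X ω) * χ ω ∂μ ≤ (∫ ω, χ ω ∂μ) * Real.exp (a * t ^ 2 / 2)) :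
    ∫ ω, X ω ^ 2 * χ ω ∂μ ≤ a * ∫ ω, χ ω ∂μ := by
  -- for every `t ∈ (0, T]`: `∫ X²χ ≤ a·exp(a t²/2)·∫χ`
  have hbound : ∀ t ∈ Ioc (0 : ℝ) T, ∫ ω, X ω ^ 2 * χ ω ∂μ ≤ a * Real.exp (a * t ^ 2 / 2) * ∫ ω, χ ω ∂μ := by
    intro t ht
    have hp' : ∫ ω, Real.exp (t * X ω) * χ ω ∂μ ≤ (∫ ω, χ ω ∂μ) * Real.exp (a * t ^ 2 / 2 + 0 * t) := by
      simpa using hp t ht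
    have hm' : ∫ ω, Real.exp (-t * X ω) * χ ω ∂μ ≤ (∫ ω, χ ω ∂μ) * Real.exp (a * t ^ 2 / 2 + 0 * t) := by
      simpa using hm t ht
    have h := integral_sq_mul_weight_le_of_subgaussian_mgf' μ hXm hχm hXB hχ0 hχM ht.1 ha le_rfl hp' hm'
    simpa using h
  -- the right-hand side tends to `a·∫χ` as `t → 0⁺`
  have hcont : Tendsto (fun t : ℝ => a * Real.exp (a * t ^ 2 / 2) * ∫ ω, χ ω ∂μ) (𝓝[>] 0) (𝓝 (a * ∫ ω, χ ω ∂μ)) := by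
    have hc : Continuous fun t : ℝ => a * Real.exp (a * t ^ 2 / 2) * ∫ ω, χ ω ∂μ := by continuity
    have h0 := hc.tendsto 0
    simp only [mul_zero, zero_pow two_ne_zero, zero_div, Real.exp_zero, mul_one] at h0
    -- `0 ^ 2` bookkeeping
    have : (fun t : ℝ => a * Real.exp (a * t ^ 2 / 2) * ∫ ω, χ ω ∂μ) 0 = a * ∫ ω, χ ω ∂μ := by simp
    exact (hc.tendsto' 0 _ this).mono_left nhdsWithin_le_nhds
  have hev : ∀ᶠ t in 𝓝[>] (0 : ℝ), ∫ ω, X ω ^ 2 * χ ω ∂μ ≤ a * Real.exp (a * t ^ 2 / 2) * ∫ ω, χ ω ∂μ := by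
    have hmem : Ioo (0 : ℝ) T ∈ 𝓝[>] (0 : ℝ) := Ioo_mem_nhdsGT hT
    exact Filter.mem_of_superset hmem fun t ht => hbound t (Ioo_subset_Ioc_self ht)
  exact ge_of_tendsto hcont hev

end Weighted

end Summit.QuantumFields.YangMills.Theorems.UnitScaleGibbsMGFSecondMoment

end
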